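import Summits.BirchSwinnertonDyer.BirchSwinnertonDyer.Theorems.SylvesterTwoHeegnerIndexUpperOffV0DescentDefectClaimB
import HarnessLib

/-!
# K7t crux `UpperOffV0HSY` (item 19581): Kolyvagin's descent modulo `p^M` without parity —
# Claim B in general and the annihilation theorem with defects

Third file of the parity-free abstract count (design and dictionary in
`…UpperOffV0DescentDefectClaimA`; Steps B/C in `…ClaimB`).  Here: Claim B for classes independent of
`x` in general (`claimB_indep_defect'`: `p^{2M₀+2δ+1} s = 0`, the socle configuration paid for by ONE
extra Čebotarev instance `hceb₁`), the splitting `s = k x + s'` (`exists_split`, verbatim port),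
Claim B (`claimB_of_indep`), the eigen-decomposition at the price of the factor `2`
(`two_mul_pow_zsmul_mem_zmultiples`), and the assembled annihilation theorems
**`2 · p^{2M₀+2δ} · Sel ⊆ ℤ x`** (`descent_defect`, socle hypothesis) and
**`2 · p^{2M₀+2δ+1} · Sel ⊆ ℤ x`** (`descent_defect'`).  At `p = 2`, `δ = 1` these are the generic
2-adic Kolyvagin EXPONENT bounds `2^{2M₀+3}` / `2^{2M₀+4}` that steps (d)(e) of line `offv0-kolyvagin2`
can feed — the typed distance to the crux's sharp ORDER bound `2M₀` (no source; B14 = O12 open as a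
class).  Route `SylvesterTwoHeegnerIndex` (cell bsd-cm, rung K7t); pure algebra, no definition, no
named fact.
-/

noncomputable section

open scoped Classical

set_option autoImplicit false
set_option linter.dupNamespace false

namespace Summit.BirchSwinnertonDyer.BirchSwinnertonDyer.Theorems.SylvesterTwoUpper.DescentDefect

open Literature.NumberTheory.EllipticCurves.KolyvaginDescent

variable {V : Type*} [AddCommGroup V] {p M : ℕ}
variable {Pl : Type*} {M₀ δ : ℕ} {τ : V →+ V} {Sel : AddSubgroup V} {Loc : Pl → AddSubgroup V}
  {Kol : ℕ → Prop} {pl : ℕ → Pl} {Dv : Pl → ℕ → Prop} {A : ℕ → AddSubgroup V} {x : V} {ε : ℤ}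
  {c : ℕ → V}

/-- **Claim B for classes independent of `x`, parity-free, with defects, in general:
`p^{2M₀+2δ+1} s = 0`**, granted ONE MORE instance of Čebotarev (`hceb₁`: Cor. 3.2 for the
eigen-family `{x, s, d}`, `d ∈ V^{-ε}`, with the single relation "socle of `ℤ d` = socle of `ℤ x`",
prescribing `x_{λ'} = 0`, `ord s_{λ'} = ord s` and `ord d_{λ'} ≥ p^{k-1}` — the most the relation
allows; at `p = 2` this is McCallum's (2) for the INDEPENDENT family `{x, s, d - p^{M-k} x}` followed by
Step B at `2`).  In the socle configuration Step C runs with `k' = k - 1`, costing one `p`.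
[cite: GrossLMS1991, §10 Claim 10.3] [cite: McCallumLMS1991, Cor. 3.2, §5] -/
theorem claimB_indep_defect' (hp : p.Prime) (torsion : ∀ v : V, ((p : ℤ) ^ M) • v = 0)
    (mem_sel_iff : ∀ s, s ∈ Sel ↔ ∀ v, s ∈ Loc v)
    (prime_of_kol : ∀ ℓ, Kol ℓ → ℓ.Prime)
    (dv_iff : ∀ ℓ, Kol ℓ → ∀ v, Dv v ℓ ↔ v = pl ℓ)
    (dv_mul : ∀ ℓ ℓ', Kol ℓ → Kol ℓ' → ∀ v, Dv v (ℓ * ℓ') → Dv v ℓ ∨ Dv v ℓ')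
    (x_ord : ((p : ℤ) ^ (M - 1)) • x ≠ 0) (hε : ε = 1 ∨ ε = -1) (τ_x : τ x = ε • x)
    (c_one : c 1 = ((p : ℤ) ^ M₀) • x)
    (τ_c : ∀ n, KolSupp Kol n → τ (c n) = (ε * (-1) ^ n.primeFactors.card) • c n)
    (c_mem_loc : ∀ n, KolSupp Kol n → ∀ v, ¬ Dv v n → c n ∈ Loc v)
    (c_mem_loc_iff : ∀ ℓ m, Kol ℓ → KolSupp Kol (ℓ * m) → ∀ a : ℕ,
      (((p : ℤ) ^ a) • c (ℓ * m) ∈ Loc (pl ℓ)) ↔ ((p : ℤ) ^ a) • c m ∈ A ℓ)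
    (duality : ∀ ℓ, Kol ℓ → ∀ ν : ℤ, (ν = 1 ∨ ν = -1) → ∀ d, τ d = ν • d →
      (∀ v, v ≠ pl ℓ → d ∈ Loc v) → ∀ s ∈ Sel, τ s = ν • s →
      ∀ a, a < M → ((p : ℤ) ^ a) • d ∉ Loc (pl ℓ) → ((p : ℤ) ^ (M - 1 - a + δ)) • s ∈ A ℓ)
    (cebotarev : ∀ (r : ℕ) (cs : Fin r → V) (Nv : Fin r → ℕ), (∀ i, cs i ≠ 0) →
      (∀ i, Nv i ≠ 0 → ((p : ℤ) ^ (Nv i - 1)) • cs i ≠ 0) →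
      (∀ i, ∃ e : ℤ, (e = 1 ∨ e = -1) ∧ τ (cs i) = e • cs i) →
      (∀ a : Fin r → ℤ, ∑ i, a i • cs i = 0 → ∀ i, a i • cs i = 0) →
      ∀ b : ℕ, ∃ ℓ, b < ℓ ∧ Kol ℓ ∧ ∀ i, ((p : ℤ) ^ Nv i) • cs i ∈ A ℓ ∧
        (Nv i ≠ 0 → ((p : ℤ) ^ (Nv i - 1)) • cs i ∉ A ℓ))
    (hceb₁ : ∀ (s d : V) (N k : ℕ) (u : ℤ) (b : ℕ), τ s = ε • s →
      (∀ a₀ a₁ : ℤ, a₀ • x + a₁ • s = 0 → a₁ • s = 0) →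
      N ≠ 0 → ((p : ℤ) ^ N) • s = 0 → ((p : ℤ) ^ (N - 1)) • s ≠ 0 →
      τ d = (-ε) • d → 2 ≤ k → ((p : ℤ) ^ k) • d = 0 → ¬ (p : ℤ) ∣ u →
      ((p : ℤ) ^ (k - 1)) • d = u • (((p : ℤ) ^ (M - 1)) • x) →
      ∃ ℓ', b < ℓ' ∧ Kol ℓ' ∧ x ∈ A ℓ' ∧ ((p : ℤ) ^ (N - 1)) • s ∉ A ℓ' ∧
        ((p : ℤ) ^ (k - 2)) • d ∉ A ℓ')
    {s : V} (hs : s ∈ Sel) (hτs : τ s = ε • s)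
    (hind : ∀ a₀ a₁ : ℤ, a₀ • x + a₁ • s = 0 → a₁ • s = 0) :
    ((p : ℤ) ^ (2 * M₀ + 2 * δ + 1)) • s = 0 := by
  rcases Nat.lt_or_ge (2 * M₀ + 2 * δ + 1) M with hM | hM
  swap
  · exact pow_zsmul_eq_zero_of_le hM (torsion s)
  have hM₀ : M₀ < M := by omega
  obtain ⟨N, -, hN, hNmin⟩ := exists_exact_exponent torsion s
  by_cases hN0 : N = 0
  · subst hN0
    rw [pow_zero, one_zsmul] at hN
    rw [hN, smul_zero]
  have hN1 : ((p : ℤ) ^ (N - 1)) • s ≠ 0 := hNmin (N - 1) (by omega)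
  -- Step A
  set y : V := ((p : ℤ) ^ M₀) • x with hy
  obtain ⟨hy0, hy1⟩ := y_exact (M₀ := M₀) torsion x_ord hM₀
  have hyne : y ≠ 0 := fun h ↦ hy1 (by rw [← hy, h, smul_zero])
  obtain ⟨ℓ, -, hℓ, hloc⟩ := cebotarev 1 ![y] ![M - M₀]
    (fun i ↦ by
      fin_cases i
      exact hyne)
    (fun i ↦ by
      fin_cases i
      intro _
      exact hy1)
    (fun i ↦ by
      fin_cases i
      exact ⟨ε, hε, τ_y τ_x⟩)
    (fun a ha i ↦ by
      rw [Fin.sum_univ_one] at ha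
      fin_cases i
      simpa using ha) 0
  have hyA : ((p : ℤ) ^ (M - M₀ - 1)) • y ∉ A ℓ := by
    have := (hloc 0).2 (by simp only [Matrix.cons_val_zero]; omega)
    simpa using this
  have hcL : ((p : ℤ) ^ (M - M₀ - 1)) • c ℓ ∉ Loc (pl ℓ) := fun h ↦
    hyA ((c_mem_loc_iff_one prime_of_kol c_one c_mem_loc_iff hℓ _).mp h)
  obtain ⟨k, hkM, hk, hkmin⟩ := exists_exact_exponent torsion (c ℓ)
  have hklo : M - M₀ ≤ k := by
    by_contra hlt
    exact hcL (by rw [pow_zsmul_eq_zero_of_le (by omega) hk]; exact zero_mem _)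
  have hk0 : k ≠ 0 := by omega
  have hk1 : ((p : ℤ) ^ (k - 1)) • c ℓ ≠ 0 := hkmin (k - 1) (by omega)
  have hτc := τ_c_prime prime_of_kol τ_c hℓ
  -- Step B, with the socle configuration handled by `hceb₁` at the price of one `p`
  obtain ⟨ℓ', k', hlt, hℓ', hxA, hsA, hk'M, hk'lo, hk'k, hcA⟩ : ∃ ℓ' k', ℓ < ℓ' ∧ Kol ℓ' ∧ x ∈ A ℓ' ∧
      ((p : ℤ) ^ (N - 1)) • s ∉ A ℓ' ∧ k' ≤ M ∧ M₀ + δ + 1 ≤ k' ∧ k ≤ k' + 1 ∧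
      ((p : ℤ) ^ (k' - 1)) • c ℓ ∉ A ℓ' := by
    rcases exists_prime_stepB hp torsion x_ord hε τ_x cebotarev hτs hind hN0 hN hN1 hτc hk0 hk hk1
        ℓ with ⟨ℓ', hlt, hℓ', hxA, hsA, hcA⟩ | ⟨u, hu, hrel⟩
    · exact ⟨ℓ', k, hlt, hℓ', hxA, hsA, hkM, by omega, by omega, hcA⟩
    · obtain ⟨ℓ', hlt, hℓ', hxA, hsA, hcA⟩ :=
        hceb₁ s (c ℓ) N k u ℓ hτs hind hN0 hN hN1 hτc (by omega) hk hu hrel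
      exact ⟨ℓ', k - 1, hlt, hℓ', hxA, hsA, by omega, by omega, by omega,
        by rwa [show k - 1 - 1 = k - 2 by omega]⟩
  -- Step C
  have hcℓ' : ((p : ℤ) ^ (M₀ + δ)) • c ℓ' = 0 :=
    pow_zsmul_c_eq_zero_defect hp torsion mem_sel_iff prime_of_kol dv_iff x_ord hε τ_x c_one τ_c
      c_mem_loc c_mem_loc_iff duality cebotarev hℓ' hxA
  have hA := stepC_defect prime_of_kol dv_iff dv_mul hε τ_c c_mem_loc c_mem_loc_iff duality hℓ hℓ'
    hlt.ne hcℓ' hk'M hk'lo hcA hs hτs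
  have hle : N ≤ M - k' + M₀ + 2 * δ := exact_exponent_le_of_mem hA (fun _ ↦ hsA)
  exact pow_zsmul_eq_zero_of_le (by omega) hN

/-! ## §5 Splitting off `x`, Claim B, and the annihilation theorem -/

/-- **Splitting off `x`** (parity-free, verbatim from the tree): `x` has the maximal order `p^M`, so
every `s` is `k • x + s'` with `ℤ x ∩ ℤ s' = 0`. [folklore] -/
theorem exists_split (hp : p.Prime) (torsion : ∀ v : V, ((p : ℤ) ^ M) • v = 0)
    (x_ord : ((p : ℤ) ^ (M - 1)) • x ≠ 0) (s : V) :
    ∃ (k : ℤ) (s' : V), s = k • x + s' ∧ ∀ a₀ a₁ : ℤ, a₀ • x + a₁ • s' = 0 → a₁ • s' = 0 := by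
  have hxiff : ∀ k : ℤ, k • x = 0 ↔ ((p : ℤ) ^ M) ∣ k :=
    zsmul_eq_zero_iff_prime_pow_dvd hp (torsion x) x_ord
  -- `b` = least exponent with `p^b s ∈ ℤ x`
  have hex : ∃ b : ℕ, ∃ k : ℤ, ((p : ℤ) ^ b) • s = k • x := ⟨M, 0, by rw [torsion, zero_zsmul]⟩
  set b := Nat.find hex with hb
  obtain ⟨k, hk⟩ : ∃ k : ℤ, ((p : ℤ) ^ b) • s = k • x := Nat.find_spec hex
  have hmin : ∀ j < b, ∀ k' : ℤ, ((p : ℤ) ^ j) • s ≠ k' • x := fun j hj k' h ↦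
    Nat.find_min hex hj ⟨k', h⟩
  have hbM : b ≤ M := Nat.find_min' hex ⟨0, by rw [torsion, zero_zsmul]⟩
  have hdvd : ((p : ℤ) ^ b) ∣ k := by
    have h0 : (((p : ℤ) ^ (M - b)) * k) • x = 0 := by
      rw [mul_zsmul, ← hk, smul_smul, ← pow_add, Nat.sub_add_cancel hbM, torsion]
    have h1 : (p : ℤ) ^ (M - b) * (p : ℤ) ^ b ∣ (p : ℤ) ^ (M - b) * k := by
      rw [← pow_add, Nat.sub_add_cancel hbM]
      exact (hxiff _).mp h0
    have hpne : ((p : ℤ) ^ (M - b)) ≠ 0 := pow_ne_zero _ (by exact_mod_cast hp.ne_zero)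
    exact (mul_dvd_mul_iff_left hpne).mp h1
  obtain ⟨k', rfl⟩ := hdvd
  refine ⟨k', s - k' • x, by abel, fun a₀ a₁ h ↦ ?_⟩
  have hs' : ((p : ℤ) ^ b) • (s - k' • x) = 0 := by
    rw [zsmul_sub, hk, smul_smul]
    exact sub_self _
  by_cases ha₁ : a₁ = 0
  · rw [ha₁, zero_zsmul]
  obtain ⟨j, β, hβ, rfl⟩ : ∃ j : ℕ, ∃ β : ℤ, ¬ (p : ℤ) ∣ β ∧ a₁ = (p : ℤ) ^ j * β := by
    have hfin : FiniteMultiplicity (p : ℤ) a₁ :=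
      Int.finiteMultiplicity_iff.mpr ⟨by rw [Int.natAbs_natCast]; exact hp.one_lt.ne', ha₁⟩
    obtain ⟨β, hβ, hnd⟩ := hfin.exists_eq_pow_mul_and_not_dvd
    exact ⟨multiplicity (p : ℤ) a₁, β, hnd, hβ⟩
  rcases Nat.lt_or_ge j b with hjb | hjb
  · exfalso
    obtain ⟨u, hu⟩ := exists_mul_zsmul_eq_of_not_dvd hp torsion hβ
    have h1 : ((p : ℤ) ^ j * β) • (s - k' • x) = (-a₀) • x := by
      rw [neg_smul]
      exact eq_neg_of_add_eq_zero_right h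
    have h2 : ((p : ℤ) ^ j) • (s - k' • x) = (u * -a₀) • x :=
      calc ((p : ℤ) ^ j) • (s - k' • x)
          = (u * β) • (((p : ℤ) ^ j) • (s - k' • x)) := (hu _).symm
        _ = u • (((p : ℤ) ^ j * β) • (s - k' • x)) := by
          rw [smul_smul, smul_smul]
          congr 1
          ring
        _ = u • ((-a₀) • x) := by rw [h1]
        _ = (u * -a₀) • x := smul_smul _ _ _
    have h3 : ((p : ℤ) ^ j) • s =
        ((p : ℤ) ^ j) • (s - k' • x) + (((p : ℤ) ^ j) * k') • x := by
      rw [smul_sub, mul_smul]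
      abel
    exact hmin j hjb _ (by rw [h3, h2, ← add_smul])
  · rw [mul_comm, mul_smul, pow_zsmul_eq_zero_of_le hjb hs', smul_zero]

/-- **Claim B from its independent case** (parity-free): if `p^E` kills every `s ∈ Sel^{ε}` with
`ℤ x ∩ ℤ s = 0`, then `p^E s ∈ ℤ x` for every `s ∈ Sel^{ε}` (`exists_split`).
[cite: GrossLMS1991, §10 Claim 10.3] -/
theorem claimB_of_indep (hp : p.Prime) (torsion : ∀ v : V, ((p : ℤ) ^ M) • v = 0)
    (x_mem : x ∈ Sel) (x_ord : ((p : ℤ) ^ (M - 1)) • x ≠ 0) (τ_x : τ x = ε • x) {E : ℕ}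
    (hB : ∀ s ∈ Sel, τ s = ε • s → (∀ a₀ a₁ : ℤ, a₀ • x + a₁ • s = 0 → a₁ • s = 0) →
      ((p : ℤ) ^ E) • s = 0)
    {s : V} (hs : s ∈ Sel) (hτs : τ s = ε • s) : ∃ a : ℤ, ((p : ℤ) ^ E) • s = a • x := by
  obtain ⟨k, s', hsplit, hind⟩ := exists_split hp torsion x_ord s
  have hs'eq : s' = s - k • x := by rw [hsplit]; abel
  have hs' : s' ∈ Sel := by
    rw [hs'eq]
    exact Sel.sub_mem hs (Sel.zsmul_mem x_mem _)
  have hτs' : τ s' = ε • s' := by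
    rw [hs'eq, map_sub, map_zsmul, hτs, τ_x, zsmul_sub, smul_comm]
  have h0 := hB s' hs' hτs' hind
  refine ⟨(p : ℤ) ^ E * k, ?_⟩
  rw [hsplit, zsmul_add, h0, add_zero, smul_smul]

/-- **The annihilation theorem from the two claims, parity-free: `2 · p^{E₂} · Sel ⊆ ℤ x`** when
`p^{E₁}` kills `Sel^{-ε}`, `p^{E₂} Sel^{ε} ⊆ ℤ x` and `E₁ ≤ E₂`: every `s ∈ Sel` has
`2 s = (s + ε τ s) + (s − ε τ s) ∈ Sel^{ε} + Sel^{-ε}` (the tree's `InvolutionDefect` at the Selmer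
level; for odd `p` the factor `2` is a unit and this is `HypothesesM.pow_zsmul_mem_zmultiples`).
[cite: GrossLMS1991, Thm. 1.3 and §10] [cite: McCallumLMS1991, §1 Theorem (Kolyvagin), §5] -/
theorem two_mul_pow_zsmul_mem_zmultiples (τ_τ : ∀ v, τ (τ v) = v) (τ_mem : ∀ s ∈ Sel, τ s ∈ Sel)
    (hε : ε = 1 ∨ ε = -1) {E₁ E₂ : ℕ} (hE : E₁ ≤ E₂)
    (hA : ∀ s ∈ Sel, τ s = (-ε) • s → ((p : ℤ) ^ E₁) • s = 0)
    (hB : ∀ s ∈ Sel, τ s = ε • s → ∃ a : ℤ, ((p : ℤ) ^ E₂) • s = a • x)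
    {s : V} (hs : s ∈ Sel) : (2 * (p : ℤ) ^ E₂) • s ∈ AddSubgroup.zmultiples x := by
  have he := sign_mul_self hε
  set sp := s + ε • τ s with hsp
  set sm := s - ε • τ s with hsm
  have hτsp : τ sp = ε • sp := by
    simp only [hsp, map_add, map_zsmul, τ_τ]
    linear_combination (norm := module) he • (-(τ s))
  have hτsm : τ sm = (-ε) • sm := by
    simp only [hsm, map_sub, map_zsmul, τ_τ]
    linear_combination (norm := module) he • (-(τ s))
  have hsp_mem : sp ∈ Sel := Sel.add_mem hs (Sel.zsmul_mem (τ_mem s hs) _)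
  have hsm_mem : sm ∈ Sel := Sel.sub_mem hs (Sel.zsmul_mem (τ_mem s hs) _)
  have hsm0 : ((p : ℤ) ^ E₂) • sm = 0 := pow_zsmul_eq_zero_of_le hE (hA sm hsm_mem hτsm)
  obtain ⟨a, ha⟩ := hB sp hsp_mem hτsp
  have hsum : (2 : ℤ) • s = sp + sm := by
    simp only [hsp, hsm]
    linear_combination (norm := module)
  rw [mul_comm, mul_zsmul, hsum, zsmul_add, hsm0, add_zero, ha]
  exact AddSubgroup.zsmul_mem_zmultiples _ _

/-- **Kolyvagin's annihilation modulo `p^M` without parity, with defects — socle form: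
`2 · p^{2M₀+2δ} · Sel ⊆ ℤ x`.**  The displayed data are the fields of the tree's
`KolyvaginDescent.HypothesesM` for an ARBITRARY prime `p` (no `hp2`), the duality with defect `δ`, and
the socle hypothesis `hsoc` (no Kolyvagin class `c(ℓ)` meets `ℤ x`).  At `p = 2`, `δ = 1` (the CM curves
`y² = x³ − c` of the K7t line, where Lemma 5.3 loses exactly one `2`): `2^{2M₀+3} S_{2^M}(E/K) ⊆ ℤ δ_M x₀`
off the socle configuration — the generic 2-adic count, three powers of `2` above the crux's sharp
`2M₀`. [cite: GrossLMS1991, Thm. 1.3, §10] [cite: McCallumLMS1991, §1 Theorem (Kolyvagin), §§3–5] -/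
theorem descent_defect (hp : p.Prime) (torsion : ∀ v : V, ((p : ℤ) ^ M) • v = 0)
    (τ_τ : ∀ v, τ (τ v) = v) (τ_mem : ∀ s ∈ Sel, τ s ∈ Sel)
    (mem_sel_iff : ∀ s, s ∈ Sel ↔ ∀ v, s ∈ Loc v)
    (prime_of_kol : ∀ ℓ, Kol ℓ → ℓ.Prime)
    (dv_iff : ∀ ℓ, Kol ℓ → ∀ v, Dv v ℓ ↔ v = pl ℓ)
    (dv_mul : ∀ ℓ ℓ', Kol ℓ → Kol ℓ' → ∀ v, Dv v (ℓ * ℓ') → Dv v ℓ ∨ Dv v ℓ')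
    (x_mem : x ∈ Sel) (x_ord : ((p : ℤ) ^ (M - 1)) • x ≠ 0) (hε : ε = 1 ∨ ε = -1)
    (τ_x : τ x = ε • x) (c_one : c 1 = ((p : ℤ) ^ M₀) • x)
    (τ_c : ∀ n, KolSupp Kol n → τ (c n) = (ε * (-1) ^ n.primeFactors.card) • c n)
    (c_mem_loc : ∀ n, KolSupp Kol n → ∀ v, ¬ Dv v n → c n ∈ Loc v)
    (c_mem_loc_iff : ∀ ℓ m, Kol ℓ → KolSupp Kol (ℓ * m) → ∀ a : ℕ,
      (((p : ℤ) ^ a) • c (ℓ * m) ∈ Loc (pl ℓ)) ↔ ((p : ℤ) ^ a) • c m ∈ A ℓ)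
    (duality : ∀ ℓ, Kol ℓ → ∀ ν : ℤ, (ν = 1 ∨ ν = -1) → ∀ d, τ d = ν • d →
      (∀ v, v ≠ pl ℓ → d ∈ Loc v) → ∀ s ∈ Sel, τ s = ν • s →
      ∀ a, a < M → ((p : ℤ) ^ a) • d ∉ Loc (pl ℓ) → ((p : ℤ) ^ (M - 1 - a + δ)) • s ∈ A ℓ)
    (cebotarev : ∀ (r : ℕ) (cs : Fin r → V) (Nv : Fin r → ℕ), (∀ i, cs i ≠ 0) →
      (∀ i, Nv i ≠ 0 → ((p : ℤ) ^ (Nv i - 1)) • cs i ≠ 0) →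
      (∀ i, ∃ e : ℤ, (e = 1 ∨ e = -1) ∧ τ (cs i) = e • cs i) →
      (∀ a : Fin r → ℤ, ∑ i, a i • cs i = 0 → ∀ i, a i • cs i = 0) →
      ∀ b : ℕ, ∃ ℓ, b < ℓ ∧ Kol ℓ ∧ ∀ i, ((p : ℤ) ^ Nv i) • cs i ∈ A ℓ ∧
        (Nv i ≠ 0 → ((p : ℤ) ^ (Nv i - 1)) • cs i ∉ A ℓ))
    (hsoc : ∀ ℓ, Kol ℓ → ∀ a₀ a₂ : ℤ, a₂ • c ℓ = a₀ • x → a₂ • c ℓ = 0)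
    {s : V} (hs : s ∈ Sel) :
    (2 * (p : ℤ) ^ (2 * M₀ + 2 * δ)) • s ∈ AddSubgroup.zmultiples x :=
  two_mul_pow_zsmul_mem_zmultiples τ_τ τ_mem hε (E₁ := M₀ + δ) (by omega)
    (fun _ hs' hτs' ↦ claimA_defect hp torsion prime_of_kol dv_iff x_ord hε τ_x c_one τ_c c_mem_loc
      c_mem_loc_iff duality cebotarev hs' hτs')
    (fun _ hs' hτs' ↦ claimB_of_indep hp torsion x_mem x_ord τ_x
      (fun _ hs'' hτs'' hind ↦ claimB_indep_defect hp torsion mem_sel_iff prime_of_kol dv_iff dv_mul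
        x_ord hε τ_x c_one τ_c c_mem_loc c_mem_loc_iff duality cebotarev hsoc hs'' hτs'' hind)
      hs' hτs')
    hs

/-- **Kolyvagin's annihilation modulo `p^M` without parity, with defects — general form:
`2 · p^{2M₀+2δ+1} · Sel ⊆ ℤ x`**, the socle hypothesis replaced by the extra Čebotarev instance
`hceb₁`.  At `p = 2`, `δ = 1`: `2^{2M₀+4} S_{2^M}(E/K) ⊆ ℤ δ_M x₀` — the generic 2-adic Kolyvagin
EXPONENT bound that steps (d)(e) of line `offv0-kolyvagin2` can feed; the crux `UpperOffV0HSY` asks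
for the ORDER bound with constant `0`, for which no source exists (B14 = O12 open as a class).
[cite: GrossLMS1991, Thm. 1.3, §10] [cite: McCallumLMS1991, §1 Theorem (Kolyvagin), §§3–5] -/
theorem descent_defect' (hp : p.Prime) (torsion : ∀ v : V, ((p : ℤ) ^ M) • v = 0)
    (τ_τ : ∀ v, τ (τ v) = v) (τ_mem : ∀ s ∈ Sel, τ s ∈ Sel)
    (mem_sel_iff : ∀ s, s ∈ Sel ↔ ∀ v, s ∈ Loc v)
    (prime_of_kol : ∀ ℓ, Kol ℓ → ℓ.Prime)
    (dv_iff : ∀ ℓ, Kol ℓ → ∀ v, Dv v ℓ ↔ v = pl ℓ)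
    (dv_mul : ∀ ℓ ℓ', Kol ℓ → Kol ℓ' → ∀ v, Dv v (ℓ * ℓ') → Dv v ℓ ∨ Dv v ℓ')
    (x_mem : x ∈ Sel) (x_ord : ((p : ℤ) ^ (M - 1)) • x ≠ 0) (hε : ε = 1 ∨ ε = -1)
    (τ_x : τ x = ε • x) (c_one : c 1 = ((p : ℤ) ^ M₀) • x)
    (τ_c : ∀ n, KolSupp Kol n → τ (c n) = (ε * (-1) ^ n.primeFactors.card) • c n)
    (c_mem_loc : ∀ n, KolSupp Kol n → ∀ v, ¬ Dv v n → c n ∈ Loc v)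
    (c_mem_loc_iff : ∀ ℓ m, Kol ℓ → KolSupp Kol (ℓ * m) → ∀ a : ℕ,
      (((p : ℤ) ^ a) • c (ℓ * m) ∈ Loc (pl ℓ)) ↔ ((p : ℤ) ^ a) • c m ∈ A ℓ)
    (duality : ∀ ℓ, Kol ℓ → ∀ ν : ℤ, (ν = 1 ∨ ν = -1) → ∀ d, τ d = ν • d →
      (∀ v, v ≠ pl ℓ → d ∈ Loc v) → ∀ s ∈ Sel, τ s = ν • s →
      ∀ a, a < M → ((p : ℤ) ^ a) • d ∉ Loc (pl ℓ) → ((p : ℤ) ^ (M - 1 - a + δ)) • s ∈ A ℓ)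
    (cebotarev : ∀ (r : ℕ) (cs : Fin r → V) (Nv : Fin r → ℕ), (∀ i, cs i ≠ 0) →
      (∀ i, Nv i ≠ 0 → ((p : ℤ) ^ (Nv i - 1)) • cs i ≠ 0) →
      (∀ i, ∃ e : ℤ, (e = 1 ∨ e = -1) ∧ τ (cs i) = e • cs i) →
      (∀ a : Fin r → ℤ, ∑ i, a i • cs i = 0 → ∀ i, a i • cs i = 0) →
      ∀ b : ℕ, ∃ ℓ, b < ℓ ∧ Kol ℓ ∧ ∀ i, ((p : ℤ) ^ Nv i) • cs i ∈ A ℓ ∧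
        (Nv i ≠ 0 → ((p : ℤ) ^ (Nv i - 1)) • cs i ∉ A ℓ))
    (hceb₁ : ∀ (s d : V) (N k : ℕ) (u : ℤ) (b : ℕ), τ s = ε • s →
      (∀ a₀ a₁ : ℤ, a₀ • x + a₁ • s = 0 → a₁ • s = 0) →
      N ≠ 0 → ((p : ℤ) ^ N) • s = 0 → ((p : ℤ) ^ (N - 1)) • s ≠ 0 →
      τ d = (-ε) • d → 2 ≤ k → ((p : ℤ) ^ k) • d = 0 → ¬ (p : ℤ) ∣ u →
      ((p : ℤ) ^ (k - 1)) • d = u • (((p : ℤ) ^ (M - 1)) • x) →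
      ∃ ℓ', b < ℓ' ∧ Kol ℓ' ∧ x ∈ A ℓ' ∧ ((p : ℤ) ^ (N - 1)) • s ∉ A ℓ' ∧
        ((p : ℤ) ^ (k - 2)) • d ∉ A ℓ')
    {s : V} (hs : s ∈ Sel) :
    (2 * (p : ℤ) ^ (2 * M₀ + 2 * δ + 1)) • s ∈ AddSubgroup.zmultiples x :=
  two_mul_pow_zsmul_mem_zmultiples τ_τ τ_mem hε (E₁ := M₀ + δ) (by omega)
    (fun _ hs' hτs' ↦ claimA_defect hp torsion prime_of_kol dv_iff x_ord hε τ_x c_one τ_c c_mem_loc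
      c_mem_loc_iff duality cebotarev hs' hτs')
    (fun _ hs' hτs' ↦ claimB_of_indep hp torsion x_mem x_ord τ_x
      (fun _ hs'' hτs'' hind ↦ claimB_indep_defect' hp torsion mem_sel_iff prime_of_kol dv_iff dv_mul
        x_ord hε τ_x c_one τ_c c_mem_loc c_mem_loc_iff duality cebotarev hceb₁ hs'' hτs'' hind)
      hs' hτs')
    hs

end Summit.BirchSwinnertonDyer.BirchSwinnertonDyer.Theorems.SylvesterTwoUpper.DescentDefect

end
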